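import Literature.NumberTheory.GaloisRepresentations.LocalGlobalCohomologyTateProofs
import Literature.NumberTheory.GaloisRepresentations.KummerSES
import Literature.NumberTheory.GaloisRepresentations.TateDualityCounting
import Literature.NumberTheory.GaloisRepresentations.HomDualPresentation
import HarnessLib

noncomputable section

/-!
# `Hom(M, μₙ) ≅ Hom_ℤ(M, k̄ˣ)` for an `n`-torsion discrete Galois module

Topic `NumberTheory/GaloisRepresentations`; namespace `Literature.NumberTheory.GaloisRepresentations.HomDual`.
Definitions with bodies and theorems; no named fact, no instance, no `sorry`.

For a field `k`, a finite discrete `Γ_k`-module `M` (`τ : DiscreteGaloisModule k M`) and `n : ℕ`, composing with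
the Kummer inclusion `μₙ(k̄) ↪ k̄ˣ` (`kummerInclAddHom`) gives an injective `Γ_k`-equivariant map

  `Hom(M, μₙ(k̄)) = ContinuousRep.homRep τ (mu k n) ⟶ Hom_ℤ(M, k̄ˣ) = homGaloisModule τ (units k)`,

and when `n • M = 0` it is bijective (a homomorphism out of an `n`-torsion group into `k̄ˣ` takes values in
`μₙ`), hence an isomorphism of topological representations inducing bijections on every `Hⁱ(k, –)`.
Over a number field `K` at a finite place `v`, composed with the tree's
`tateDualLocalIso v ρ n : (ρ.tateDual n)|_{Γ_{K_v}} ≅ Hom(M|_{Γ_{K_v}}, μₙ(K̄_v))`, this identifies the local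
restriction of the global Tate dual with `Hom_ℤ(M|_{Γ_{K_v}}, K̄_vˣ)` — the codomain in which the native
connecting map `HomDual.dualδ₀` of the dual of a presentation of `M` lives (door-c6 g16 presentation road,
readout `R_v`).

References: Milne, *Arithmetic Duality Theorems*, I §0 and I §2 (the dual `M^D = Hom(M, μₙ) = Hom(M, k̄ˣ)` for
`n`-torsion `M`); Serre, *Galois Cohomology*, II §1.2.
-/

namespace Literature.NumberTheory.GaloisRepresentations

namespace HomDual

open Function Literature.Algebra.Homology Literature.Algebra.Homology.DiscreteRep ContRepresentation Field DiscreteGaloisModule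

universe u

section Generic

variable (k : Type) [Field k] {M : Type} [AddCommGroup M] (n : ℕ)

/-! ## §1 The map `Hom(M, μₙ) → Hom_ℤ(M, k̄ˣ)`, `F ↦ ι ∘ F` -/

/-- **`Hom(M, μₙ(k̄)) → Hom_ℤ(M, k̄ˣ)`, `F ↦ ι ∘ F`** (`ι : μₙ ↪ k̄ˣ` the Kummer inclusion), on carriers.
[cite: MilneADT2006, I §0] -/
def homMuUnits : HomCarrier M (MuCarrier k n) →+ DiscreteRep.HomCarrier M (UnitsCarrier k) where
  toFun F := ((kummerInclAddHom k n).comp (show M →+ MuCarrier k n from F)).toIntLinearMap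
  map_zero' := LinearMap.ext fun _ => by
    change kummerInclAddHom k n 0 = 0
    exact map_zero _
  map_add' F G := LinearMap.ext fun m => by
    change kummerInclAddHom k n (F m + G m) = kummerInclAddHom k n (F m) + kummerInclAddHom k n (G m)
    exact map_add _ _ _

/-- Unfolding: `(homMuUnits F) m = ι (F m)`. [cite: MilneADT2006, I §0] -/
@[simp] theorem homMuUnits_apply (F : HomCarrier M (MuCarrier k n)) (m : M) :
    (show M →ₗ[ℤ] UnitsCarrier k from homMuUnits k n F) m = kummerInclAddHom k n (F m) := rfl

/-- `unitsVal ((homMuUnits F) m) = muVal (F m)`. [cite: MilneADT2006, I §0] -/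
@[simp] theorem unitsVal_homMuUnits_apply (F : HomCarrier M (MuCarrier k n)) (m : M) :
    unitsVal k ((show M →ₗ[ℤ] UnitsCarrier k from homMuUnits k n F) m) = muVal k n (F m) := rfl

/-- The Kummer inclusion on carriers is injective. [cite: SerreGaloisCohomology1997, II §1.2] -/
theorem kummerInclAddHom_injective : Injective (kummerInclAddHom k n) := fun v w h =>
  muVal_injective k n (by rw [← unitsVal_kummerInclAddHom, ← unitsVal_kummerInclAddHom, h])

/-- `F ↦ ι ∘ F` is injective. [cite: MilneADT2006, I §0] -/
theorem homMuUnits_injective : Injective (homMuUnits k n (M := M)) := fun _ _ h =>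
  HomCarrier.ext fun m => kummerInclAddHom_injective k n
    (LinearMap.congr_fun (congrArg (fun H : DiscreteRep.HomCarrier M (UnitsCarrier k) =>
      (show M →ₗ[ℤ] UnitsCarrier k from H)) h) m)

/-- `unitsVal (n • u) = (unitsVal u) ^ n`. [cite: SerreGaloisCohomology1997, II §1.2] -/
theorem unitsVal_nsmul (u : UnitsCarrier k) : unitsVal k (n • u) = unitsVal k u ^ n := by
  rw [← natCast_zsmul, unitsVal_zsmul, zpow_natCast]

/-- A `ℤ`-linear map out of an `n`-torsion group into `k̄ˣ` takes values in `μₙ`: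
`(unitsVal (F m)) ^ n = 1`. [cite: MilneADT2006, I §0] -/
theorem unitsVal_pow_eq_one_of_torsion (hM : ∀ m : M, n • m = 0) (F : M →ₗ[ℤ] UnitsCarrier k) (m : M) :
    unitsVal k (F m) ^ n = 1 := by
  rw [← unitsVal_nsmul, ← map_nsmul, hM, map_zero]
  rfl

/-- The preimage of a `ℤ`-linear `F : M → k̄ˣ` (`M` `n`-torsion) in `Hom(M, μₙ)`. [cite: MilneADT2006, I §0] -/
def homMuUnitsInv (hM : ∀ m : M, n • m = 0) (F : M →ₗ[ℤ] UnitsCarrier k) : HomCarrier M (MuCarrier k n) :=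
  show M →+ MuCarrier k n from
  { toFun := fun m => muOfUnit k n (unitsVal k (F m)) (unitsVal_pow_eq_one_of_torsion k n hM F m)
    map_zero' := muVal_injective k n (by rw [muVal_muOfUnit, map_zero, muVal_zero]; rfl)
    map_add' := fun m m' => muVal_injective k n (by
      rw [muVal_muOfUnit, muVal_add, muVal_muOfUnit, muVal_muOfUnit, map_add, unitsVal_add]) }

/-- `muVal ((homMuUnitsInv F) m) = unitsVal (F m)`. [cite: MilneADT2006, I §0] -/
@[simp] theorem muVal_homMuUnitsInv_apply (hM : ∀ m : M, n • m = 0) (F : M →ₗ[ℤ] UnitsCarrier k) (m : M) :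
    muVal k n (homMuUnitsInv k n hM F m) = unitsVal k (F m) := rfl

/-- `homMuUnits (homMuUnitsInv F) = F`. [cite: MilneADT2006, I §0] -/
theorem homMuUnits_homMuUnitsInv (hM : ∀ m : M, n • m = 0) (F : M →ₗ[ℤ] UnitsCarrier k) :
    homMuUnits k n (homMuUnitsInv k n hM F) = (show DiscreteRep.HomCarrier M (UnitsCarrier k) from F) :=
  LinearMap.ext fun m => unitsVal_injective k (by
    rw [unitsVal_homMuUnits_apply, muVal_homMuUnitsInv_apply])

/-- **For `n`-torsion `M`, `F ↦ ι ∘ F : Hom(M, μₙ) → Hom_ℤ(M, k̄ˣ)` is surjective.** [cite: MilneADT2006, I §0] -/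
theorem homMuUnits_surjective (hM : ∀ m : M, n • m = 0) : Surjective (homMuUnits k n (M := M)) := fun F =>
  ⟨homMuUnitsInv k n hM (show M →ₗ[ℤ] UnitsCarrier k from F), homMuUnits_homMuUnitsInv k n hM _⟩

/-- For `n`-torsion `M`, `F ↦ ι ∘ F` is bijective. [cite: MilneADT2006, I §0] -/
theorem homMuUnits_bijective (hM : ∀ m : M, n • m = 0) : Bijective (homMuUnits k n (M := M)) :=
  ⟨homMuUnits_injective k n, homMuUnits_surjective k n hM⟩

/-! ## §2 Equivariance and the isomorphism of Galois modules -/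

variable [TopologicalSpace M] [DiscreteTopology M] [Finite M] (τ : DiscreteGaloisModule k M)

/-- **`F ↦ ι ∘ F` is `Γ_k`-equivariant**: `ι ∘ (σF σ⁻¹) = σ (ι ∘ F) σ⁻¹`. [cite: MilneADT2006, I §0] -/
theorem homMuUnits_smul (σ : absoluteGaloisGroup k) (F : HomCarrier M (MuCarrier k n)) :
    homMuUnits k n (τ.homRep (mu k n) σ F) = homGaloisModule τ (units k) σ (homMuUnits k n F) := by
  refine LinearMap.ext fun m => unitsVal_injective k ?_
  change unitsVal k (kummerInclAddHom k n (mu k n σ (F (τ σ⁻¹ m)))) =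
    unitsVal k (units k σ (kummerInclAddHom k n (F (τ σ⁻¹ m))))
  rw [unitsVal_kummerInclAddHom, muVal_apply, unitsVal_apply, unitsVal_kummerInclAddHom]

/-- **`Hom(M, μₙ) → Hom_ℤ(M, k̄ˣ)` as a morphism of discrete `Γ_k`-modules** (continuous intertwining map).
[cite: MilneADT2006, I §0] -/
def homMuUnitsHom : (τ.homRep (mu k n)).toContRepresentation →ⁱL (homGaloisModule τ (units k)).toContRepresentation where
  toLinearMap := (homMuUnits k n (M := M)).toIntLinearMap
  cont := continuous_of_discreteTopology
  isIntertwining' σ := by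
    refine ContinuousLinearMap.ext fun F => ?_
    simpa [ContinuousRep.toContRepresentation_apply_apply] using homMuUnits_smul k n τ σ F

/-- Unfolding `homMuUnitsHom`. [cite: MilneADT2006, I §0] -/
@[simp] theorem homMuUnitsHom_apply (F : HomCarrier M (MuCarrier k n)) :
    homMuUnitsHom k n τ F = homMuUnits k n F := rfl

/-- **`Hom(M, μₙ) ≅ Hom_ℤ(M, k̄ˣ)` in `TopRep` for `n`-torsion `M`.** [cite: MilneADT2006, I §0, I §2] -/
def homMuUnitsIso (hM : ∀ m : M, n • m = 0) :
    (τ.homRep (mu k n)).toTopRep ≅ (homGaloisModule τ (units k)).toTopRep :=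
  topRepIsoOfEquiv (X := (τ.homRep (mu k n)).toTopRep) (Y := (homGaloisModule τ (units k)).toTopRep)
    { (AddEquiv.ofBijective (homMuUnits k n (M := M)) (homMuUnits_bijective k n hM)).toIntLinearEquiv with
      continuous_toFun := continuous_of_discreteTopology
      continuous_invFun := continuous_of_discreteTopology }
    fun σ F => homMuUnits_smul k n τ σ F

/-- Unfolding `homMuUnitsIso` on elements. [cite: MilneADT2006, I §0] -/
@[simp] theorem homMuUnitsIso_hom_apply (hM : ∀ m : M, n • m = 0) (F : HomCarrier M (MuCarrier k n)) :
    (homMuUnitsIso k n τ hM).hom.hom F = homMuUnits k n F := rfl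

/-- The morphism underlying `homMuUnitsIso` is the one induced by `homMuUnitsHom`. [cite: MilneADT2006, I §0] -/
theorem homMuUnitsIso_hom (hM : ∀ m : M, n • m = 0) :
    (homMuUnitsIso k n τ hM).hom = toTopRepHom _ _ (homMuUnitsHom k n τ) :=
  TopRep.hom_ext (ContIntertwiningMap.ext (ContinuousLinearMap.ext fun _ => rfl))

/-- **`Hⁱ(k, Hom(M, μₙ)) → Hⁱ(k, Hom_ℤ(M, k̄ˣ))` is bijective for `n`-torsion `M`** (induced by an isomorphism of
coefficients). [cite: MilneADT2006, I §0, I §2] -/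
theorem cohomologyMap_homMuUnitsIso_bijective (hM : ∀ m : M, n • m = 0) (q : ℕ) :
    Bijective (cohomologyMap (homMuUnitsIso k n τ hM).hom q) :=
  (continuousCohomologyEquivOfIso (homMuUnitsIso k n τ hM) q).bijective

/-- The same for the tree's `galoisCohomology.map` of `homMuUnitsHom`. [cite: MilneADT2006, I §0, I §2] -/
theorem galoisCohomology_map_homMuUnitsHom_bijective (hM : ∀ m : M, n • m = 0) (q : ℕ) :
    Bijective (galoisCohomology.map (homMuUnitsHom k n τ) q) := by
  have h := cohomologyMap_homMuUnitsIso_bijective k n τ hM q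
  rw [homMuUnitsIso_hom] at h
  exact h

end Generic

/-! ## §3 Over a number field at a finite place: `(ρ.tateDual n)|_{Γ_{K_v}} ≅ Hom_ℤ(M|_{Γ_{K_v}}, K̄_vˣ)` -/

section Place

open IsDedekindDomain NumberField

variable {K : Type} [Field K] [NumberField K] (v : HeightOneSpectrum (𝓞 K))
variable {M : Type} [AddCommGroup M] [TopologicalSpace M] [DiscreteTopology M] [Finite M]

/-- **`(ρ.tateDual n)|_{Γ_{K_v}} ≅ Hom_ℤ(M|_{Γ_{K_v}}, K̄_vˣ)`** as topological `Γ_{K_v}`-representations, for a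
finite `n`-torsion Galois module `M` over a number field `K` and a finite place `v` (`n ≠ 0`): the tree's
`tateDualLocalIso` followed by `homMuUnitsIso` over `K_v`. [cite: MilneADT2006, I §0, I §2] -/
def tateDualLocalUnitsIso (ρ : DiscreteGaloisModule K M) (n : ℕ) [NeZero n]
    (hM : ∀ m : M, n • m = 0) :
    ((ρ.tateDual n).restrict (absGaloisRestrict K (v.adicCompletion K))).toTopRep ≅
      (homGaloisModule (ρ.restrict (absGaloisRestrict K (v.adicCompletion K)))
        (units (v.adicCompletion K))).toTopRep :=
  haveI : CharZero (v.adicCompletion K) := charZero_adicCompletion v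
  tateDualLocalIso v ρ n ≪≫ homMuUnitsIso (v.adicCompletion K) n (ρ.restrict (absGaloisRestrict K (v.adicCompletion K))) hM

/-- Unfolding `tateDualLocalUnitsIso` on elements: `f ↦ (m ↦ ι_v (f m))`, through `unitsVal`.
[cite: MilneADT2006, I §0, I §2] -/
theorem unitsVal_tateDualLocalUnitsIso_hom_apply (ρ : DiscreteGaloisModule K M) (n : ℕ) [NeZero n]
    (hM : ∀ m : M, n • m = 0) (f : TateDual K M n) (m : M) :
    unitsVal (v.adicCompletion K)
        ((show M →ₗ[ℤ] UnitsCarrier (v.adicCompletion K) from (tateDualLocalUnitsIso v ρ n hM).hom.hom f) m) =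
      Units.map (absClosureEmbedding K (v.adicCompletion K) : AlgebraicClosure K →* AlgebraicClosure (v.adicCompletion K))
        (muVal K n (f m)) := rfl

/-- **`Hⁱ(K_v, (ρ.tateDual n)|_v) → Hⁱ(K_v, Hom_ℤ(M|_v, K̄_vˣ))` is bijective.** [cite: MilneADT2006, I §0, I §2] -/
theorem cohomologyMap_tateDualLocalUnitsIso_bijective (ρ : DiscreteGaloisModule K M) (n : ℕ) [NeZero n]
    (hM : ∀ m : M, n • m = 0) (q : ℕ) :
    Bijective (cohomologyMap (tateDualLocalUnitsIso v ρ n hM).hom q) :=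
  (continuousCohomologyEquivOfIso (tateDualLocalUnitsIso v ρ n hM) q).bijective

/-- The inverse direction on cohomology: `Hⁱ(e.inv) ∘ Hⁱ(e.hom) = id`. [cite: MilneADT2006, I §0, I §2] -/
theorem cohomologyMap_tateDualLocalUnitsIso_inv_hom_apply (ρ : DiscreteGaloisModule K M) (n : ℕ) [NeZero n]
    (hM : ∀ m : M, n • m = 0) (q : ℕ)
    (x : continuousCohomology q ((ρ.tateDual n).restrict (absGaloisRestrict K (v.adicCompletion K))).toTopRep) :
    cohomologyMap (tateDualLocalUnitsIso v ρ n hM).inv q (cohomologyMap (tateDualLocalUnitsIso v ρ n hM).hom q x) = x :=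
  cohomologyMap_inv_hom_apply _ q x

/-- … and `Hⁱ(e.hom) ∘ Hⁱ(e.inv) = id`. [cite: MilneADT2006, I §0, I §2] -/
theorem cohomologyMap_tateDualLocalUnitsIso_hom_inv_apply (ρ : DiscreteGaloisModule K M) (n : ℕ) [NeZero n]
    (hM : ∀ m : M, n • m = 0) (q : ℕ)
    (y : continuousCohomology q (homGaloisModule (ρ.restrict (absGaloisRestrict K (v.adicCompletion K)))
        (units (v.adicCompletion K))).toTopRep) :
    cohomologyMap (tateDualLocalUnitsIso v ρ n hM).hom q (cohomologyMap (tateDualLocalUnitsIso v ρ n hM).inv q y) = y :=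
  cohomologyMap_inv_hom_apply (tateDualLocalUnitsIso v ρ n hM).symm q y

end Place

end HomDual

end Literature.NumberTheory.GaloisRepresentations

end
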